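import Literature.IUT.HodgeTheaters.StableCurveTemperedDataOfSpecialFibrePiDataProp24ii
import HarnessLib

/-!
# [IUTchI] Prop. 2.4 (ii): "this observation" (the arithmetic analogue of Prop. 2.1 at every level
# quotient) from its PRINTED inputs — [SemiAnbd] Thm. 5.4 (ii) / Ex. 5.6 and [AbsTopII] Prop. 1.3 (iv) /
# [NodNon] Prop. 3.9 (i) — over the pro-tree in coset coordinates

Mochizuki, *Inter-universal Teichmüller theory I*, kurims manuscript (May 2020), §2, proof of Prop. 2.4 (ii),
p. 50 l. 52 – p. 51 l. 13: "it follows from a similar argument to the argument applied to prove Proposition 2.1 —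
where, instead of applying [SemiAnbd], Theorem 3.7, (iii), we apply its *arithmetic analogue*, namely, [SemiAnbd],
Theorem 5.4, (ii); [SemiAnbd], Example 5.6 … — that the image of `γ` in `Π̂_X/Ker(Δ̂_X ↠ Π̂_{𝔾*})` lies in
`Π^tp_X/Ker(Δ^tp_X ↠ Π^tp_{𝔾*})` … Here, we note that when one applies either [AbsTopII], Proposition 1.3, (iv), or
[NodNon], Proposition 3.9, (i) — after, say, restricting the outer action of `G_k` on `Π^tp_{𝔾*}` to a closed
pro-`Σ` subgroup of the inertia group `I_k` … — to the vertices “`v″`”, “`(v′)^γ`”, one may only conclude that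
these two vertices either *coincide*, *are adjacent*, or *admit a common adjacent vertex*; but this is still
sufficient to conclude the *temperedness* of “`(v′)^γ`” from that of “`v″`”.  Now … by applying [the evident
analogue of] this *observation* to the quotients `Π^tp_X ↠ Π^tp_X/Ker(J ↠ Π^tp_{𝔾*_J})` … we conclude that
`γ ∈ Π^tp_X`" [cite: Mochizuki2012, Prop 2.4(ii) pp.50-51] (D-0012 claim key; nothing of the series is asserted
here), over Mochizuki, *Semi-graphs of anabelioids*, Publ. RIMS **42** (2006), Thm. 5.4 (i)(ii) p. 66 ("Every
arithmetically ample compact subgroup of `π₁^temp(𝒢)` is contained in at least one verticial subgroup … The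
arithmetically maximal compact subgroups of `π₁^temp(𝒢)` are precisely the verticial subgroups") and Ex. 5.6 p. 67
[cite: MochizukiSemiAnbd2006, Thm 5.4(ii) p.66].  Pages: [IUTchI] = kurims preprint render
IUTchI-kurims-url-690e7b3c6199; [SemiAnbd] = kurims render SemiAnbd-kurims-url-f33ace170ff4 (lit/SOURCES.md §0/§11).

PROOF-ONLY companion (abc-iut-L5-t11; no definitions, no new `Prop` fact) of abc-iut-w5-d119's sub-DAG file
`TemperedCoveringsProp24Sub.lean`, where "this observation" at every level of the quotient tower is the ONE named
input `Prop24QTower.LevelObservation` (consumed raw by every Prop. 2.4 (ii) capstone so far: `prop24ii_of_qtower`,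
abc-iut-w4-d063's `prop24ii_ofPiData`, abc-iut-f-193's one-call forms).  This file is the (ii)-twin of this
lineage's Prop. 2.1 kernels (`TemperedCoveringsProTree.lean`, p409059): it derives `LevelObservation` from the two
PRINTED citations, per level, with the covering-space steps PROVED in coset coordinates:
* `TemperedGraphGroupData.mem_range_of_proTree_orbit` — the argument of p. 45 l. 27–37 in ORBIT form for a fixed
  subgroup `M ⊆ Π̂` (no compactness bookkeeping inside the kernel): (A1) every `Π̂`-conjugate of `M` lying in
  `ι(Π^tp)` is contained in the stabiliser of a tempered pro-vertex; (A3) two stabilisers containing a common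
  conjugate of `M` are `Near`; (T2) `Near` a tempered vertex ⇒ tempered; (T3) `ṽ`, `γ·ṽ` tempered ⇒ `γ` tempered;
* `TemperedGraphGroupData.mem_range_of_cosetTree_orbit` — the same in coset coordinates on the pro-tree
  (pro-vertices `g·ṽ_v`, stabilisers `g Π_v g⁻¹`, nodes `k·ẽ_e` with end-points `k c₁(e)·ṽ_{src e}`,
  `k c₂(e)·ṽ_{tgt e}`), with `Near :=` "coincide, are adjacent, or admit a common adjacent vertex" (p. 51 l. 1–2):
  equivariance, (T2) and (T3) are PROVED (group arithmetic), leaving (A1) and (A3) in coordinates;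
* `StableCurveTemperedData.Prop24QTower.levelObservation_of_cosetTrees` — **(OBS) `LevelObservation` at every
  level `j` from (A1-arith)_j** ("a compact subgroup of the level quotient with open image in `G_k` lies in an
  arithmetic verticial subgroup", [SemiAnbd] Thm 5.4 (ii) / Ex 5.6, for the conjugates of the image `M` of `Λ`)
  **and (A3-arith)_j** ("two arithmetic verticial subgroups containing a common conjugate of `M` coincide, are
  adjacent, or admit a common adjacent vertex", [AbsTopII] Prop 1.3 (iv) / [NodNon] Prop 3.9 (i)) + per-level chart
  data (arithmetic verticial subgroups `Π_v ⊆ ι(Π^tp_j)`, nodes with tempered branch conjugators);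
* `StableCurveTemperedData.OfSpecialFibre.prop24ii_ofPiData_of_cosetTrees` — Prop. 2.4 (ii) AS TYPED at the genuine
  𝔛-datum over `P : SpecialFibreTower.PiData` (abc-iut-w4-d063's `prop24ii_ofPiData`) with `hLev` so supplied:
  laws `hadm` · (A1-arith) · (A3-arith), data the per-level arithmetic charts.
DISCHARGE ROUTE (abc-iut-L5-lead RULINGS #70 (3)): the per-level law (A1-arith)_j is [SemiAnbd] Thm. 5.4 (i)(ii) AT
THE LEVEL QUOTIENT and is meant to be supplied BY NAME from abc-iut-L3's At-forms of Thm. 5.4 at finite level graphs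
(`arithMaximalCompactStatementI_and_II_ofChartAt` and its capstones) once the level-quotient charts are identified
with L3's arithmetic charts; (A3-arith)_j stays the [AbsTopII]/[NodNon] citation.
CONDITIONAL, as labelled; typed ≠ discharged for (A1-arith)/(A3-arith)/`hadm`; `P` is origin data inhabited at model
towers only; nothing here asserts that abc is proved or refuted, and nothing here bears on [IUTchIII] Cor. 3.12.
-/

noncomputable section

namespace Literature.IUT.HodgeTheaters

open _root_.Topology
open scoped Pointwise

universe u

/-! ### A. The Prop. 2.1 argument in orbit form -/

namespace TemperedGraphGroupData

variable (D : TemperedGraphGroupData.{u})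

/-- Monotonicity of conjugation on subgroups (pointwise action of `MulAut`). [folklore] -/
private theorem conj_smul_le_conj_smul {G : Type*} [Group G] (φ : MulAut G) {A B : Subgroup G} (h : A ≤ B) :
    φ • A ≤ φ • B := by
  intro z hz
  rw [Subgroup.mem_smul_pointwise_iff_exists] at hz ⊢
  obtain ⟨a, ha, rfl⟩ := hz
  exact ⟨a, h ha, rfl⟩

/-- **The argument of [IUTchI] Prop. 2.1 (p. 45 l. 27–37) in ORBIT form**, for a fixed subgroup `M ⊆ Π̂` (the
image of the compact `Λ`) over an abstract set of pro-vertices with action `act`, equivariant stabilisers `stab`, a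
relation `Near` and a predicate `IsTemperedVertex`: (A1) every `Π̂`-conjugate `γMγ⁻¹ ⊆ ι(Π^tp)` lies in the
stabiliser of a tempered pro-vertex ([SemiAnbd] Thm 3.7 (iii), resp. Thm 5.4 (ii) in the arithmetic case);
(A3) two stabilisers containing a common conjugate of `M` are `Near` ([NodNon] Lem 1.9 (ii) / Prop 3.9 (i),
[AbsTopII] Prop 1.3 (iv)); (T2) a vertex `Near` a tempered vertex is tempered; (T3) `ṽ`, `γ·ṽ` tempered ⇒
`γ ∈ ι(Π^tp)`.  Conclusion: `M ⊆ ι(Π^tp)` and `γMγ⁻¹ ⊆ ι(Π^tp)` ⇒ `γ ∈ ι(Π^tp)`.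
([IUTchI] Prop 2.1 p.45) [claim: Mochizuki2012, status: disputed] -/
theorem mem_range_of_proTree_orbit {Vtx : Type*} (act : D.Hat → Vtx → Vtx) (stab : Vtx → Subgroup D.Hat)
    (stab_act : ∀ (γ : D.Hat) (x : Vtx), stab (act γ x) = MulAut.conj γ • stab x)
    (Near : Vtx → Vtx → Prop) (IsTemperedVertex : Vtx → Prop) (M : Subgroup D.Hat)
    (hA1 : ∀ γ : D.Hat, MulAut.conj γ • M ≤ D.ι.range →
      ∃ x, IsTemperedVertex x ∧ MulAut.conj γ • M ≤ stab x)
    (hA3 : ∀ (x y : Vtx) (γ : D.Hat), MulAut.conj γ • M ≤ stab x → MulAut.conj γ • M ≤ stab y → Near x y)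
    (hT2 : ∀ x y : Vtx, Near x y → IsTemperedVertex y → IsTemperedVertex x)
    (hT3 : ∀ (γ : D.Hat) (x : Vtx), IsTemperedVertex x → IsTemperedVertex (act γ x) →
      γ ∈ D.ι.range)
    (hM : M ≤ D.ι.range) (γ : D.Hat) (hγ : MulAut.conj γ • M ≤ D.ι.range) : γ ∈ D.ι.range := by
  -- `M ⊆ Π_{ṽ₀}` with `ṽ₀` tempered ((A1) for `γ = 1`)
  obtain ⟨x₀, hx₀, hMx₀⟩ := hA1 1 (by rw [map_one, one_smul]; exact hM)
  rw [map_one, one_smul] at hMx₀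
  -- `γMγ⁻¹ ⊆ Π_{ṽ₁}` with `ṽ₁` tempered ((A1) for `γ`)
  obtain ⟨x₁, hx₁, hMx₁⟩ := hA1 γ hγ
  -- `γMγ⁻¹ ⊆ Π_{γ·ṽ₀}` as well
  have h1 : MulAut.conj γ • M ≤ stab (act γ x₀) := by
    rw [stab_act]
    exact conj_smul_le_conj_smul _ hMx₀
  -- (A3): `γ·ṽ₀` and `ṽ₁` are near; (T2): `γ·ṽ₀` is tempered; (T3): `γ` is tempered
  exact hT3 γ x₀ hx₀ (hT2 _ _ (hA3 (act γ x₀) x₁ γ h1 hMx₁) hx₁)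

/-- In coset coordinates, ADJACENT pro-vertices share temperedness: if `(v, g)`, `(w, h)` are the end-points
`k c₁(e)·ṽ_{src e}`, `k c₂(e)·ṽ_{tgt e}` of a node `k·ẽ_e` (in either order) and `h ∈ ι(Π^tp)`, then
`g ∈ ι(Π^tp)` (the verticial subgroups and the branch conjugators are tempered). [folklore] -/
private theorem mem_range_of_adjacent {V : Type*} (Pv : V → Subgroup D.Hat) (hPv : ∀ v, Pv v ≤ D.ι.range)
    {E : Type*} (src tgt : E → V) (c₁ c₂ : E → D.Tp) {v w : V} {g h : D.Hat}
    (hadj : ∃ (e : E) (k : D.Hat), ∃ p ∈ Pv (src e), ∃ q ∈ Pv (tgt e),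
      (src e = v ∧ tgt e = w ∧ g = k * D.ι (c₁ e) * p ∧ h = k * D.ι (c₂ e) * q) ∨
      (src e = w ∧ tgt e = v ∧ h = k * D.ι (c₁ e) * p ∧ g = k * D.ι (c₂ e) * q))
    (hh : h ∈ D.ι.range) : g ∈ D.ι.range := by
  obtain ⟨e, k, p, hp, q, hq, hcase⟩ := hadj
  rcases hcase with ⟨-, -, hg', hh'⟩ | ⟨-, -, hh', hg'⟩
  · have hk : k ∈ D.ι.range := by
      have : k = h * (D.ι (c₂ e) * q)⁻¹ := by rw [hh']; group
      rw [this]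
      exact D.ι.range.mul_mem hh (D.ι.range.inv_mem (D.ι.range.mul_mem ⟨c₂ e, rfl⟩ (hPv _ hq)))
    rw [hg']
    exact D.ι.range.mul_mem (D.ι.range.mul_mem hk ⟨c₁ e, rfl⟩) (hPv _ hp)
  · have hk : k ∈ D.ι.range := by
      have : k = h * (D.ι (c₁ e) * p)⁻¹ := by rw [hh']; group
      rw [this]
      exact D.ι.range.mul_mem hh (D.ι.range.inv_mem (D.ι.range.mul_mem ⟨c₁ e, rfl⟩ (hPv _ hp)))
    rw [hg']
    exact D.ι.range.mul_mem (D.ι.range.mul_mem hk ⟨c₂ e, rfl⟩) (hPv _ hq)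

/-- **The orbit-form argument in coset coordinates on the pro-tree, with `Near :=` "coincide, are adjacent, or admit
a common adjacent vertex"** (p. 51 l. 1–2).  Data: verticial (decomposition) subgroups `Π_v ⊆ ι(Π^tp)` of chosen
tempered vertices `ṽ_v`, nodes `e` with end-vertices `src e`, `tgt e` and tempered branch conjugators `c₁ e`,
`c₂ e`.  Coordinates: pro-vertices `g·ṽ_v` (`g ∈ Π̂`), stabilisers `g Π_v g⁻¹`, `g·ṽ_v` tempered iff `g ∈ ι(Π^tp)`;
equivariance, (T2) and (T3) are PROVED.  Named inputs, in coordinates: (A1) every conjugate `γMγ⁻¹ ⊆ ι(Π^tp)` lies in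
some `g Π_v g⁻¹` with `g` tempered; (A3) if `γMγ⁻¹ ⊆ g Π_v g⁻¹ ∩ h Π_w h⁻¹` then the pro-vertices `g·ṽ_v`, `h·ṽ_w`
coincide, are adjacent, or have a common adjacent vertex.
([IUTchI] Prop 2.4(ii) pp.50-51) [claim: Mochizuki2012, status: disputed] -/
theorem mem_range_of_cosetTree_orbit {V : Type*} (Pv : V → Subgroup D.Hat) (hPv : ∀ v, Pv v ≤ D.ι.range)
    {E : Type*} (src tgt : E → V) (c₁ c₂ : E → D.Tp) (M : Subgroup D.Hat)
    (hA1 : ∀ γ : D.Hat, MulAut.conj γ • M ≤ D.ι.range →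
      ∃ (v : V) (g : D.Hat), g ∈ D.ι.range ∧ MulAut.conj γ • M ≤ MulAut.conj g • Pv v)
    (hA3 : ∀ (v w : V) (g h γ : D.Hat),
      MulAut.conj γ • M ≤ MulAut.conj g • Pv v → MulAut.conj γ • M ≤ MulAut.conj h • Pv w →
        (v = w ∧ g⁻¹ * h ∈ Pv v) ∨
        (∃ (e : E) (k : D.Hat), ∃ p ∈ Pv (src e), ∃ q ∈ Pv (tgt e),
          (src e = v ∧ tgt e = w ∧ g = k * D.ι (c₁ e) * p ∧ h = k * D.ι (c₂ e) * q) ∨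
          (src e = w ∧ tgt e = v ∧ h = k * D.ι (c₁ e) * p ∧ g = k * D.ι (c₂ e) * q)) ∨
        (∃ (u : V) (f : D.Hat),
          (∃ (e : E) (k : D.Hat), ∃ p ∈ Pv (src e), ∃ q ∈ Pv (tgt e),
            (src e = v ∧ tgt e = u ∧ g = k * D.ι (c₁ e) * p ∧ f = k * D.ι (c₂ e) * q) ∨
            (src e = u ∧ tgt e = v ∧ f = k * D.ι (c₁ e) * p ∧ g = k * D.ι (c₂ e) * q)) ∧
          (∃ (e : E) (k : D.Hat), ∃ p ∈ Pv (src e), ∃ q ∈ Pv (tgt e),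
            (src e = u ∧ tgt e = w ∧ f = k * D.ι (c₁ e) * p ∧ h = k * D.ι (c₂ e) * q) ∨
            (src e = w ∧ tgt e = u ∧ h = k * D.ι (c₁ e) * p ∧ f = k * D.ι (c₂ e) * q))))
    (hM : M ≤ D.ι.range) (γ : D.Hat) (hγ : MulAut.conj γ • M ≤ D.ι.range) : γ ∈ D.ι.range := by
  refine D.mem_range_of_proTree_orbit (Vtx := V × D.Hat) (fun δ x => (x.1, δ * x.2))
    (fun x => MulAut.conj x.2 • Pv x.1) ?_
    (fun x y => (x.1 = y.1 ∧ x.2⁻¹ * y.2 ∈ Pv x.1) ∨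
      (∃ (e : E) (k : D.Hat), ∃ p ∈ Pv (src e), ∃ q ∈ Pv (tgt e),
        (src e = x.1 ∧ tgt e = y.1 ∧ x.2 = k * D.ι (c₁ e) * p ∧ y.2 = k * D.ι (c₂ e) * q) ∨
        (src e = y.1 ∧ tgt e = x.1 ∧ y.2 = k * D.ι (c₁ e) * p ∧ x.2 = k * D.ι (c₂ e) * q)) ∨
      (∃ (u : V) (f : D.Hat),
        (∃ (e : E) (k : D.Hat), ∃ p ∈ Pv (src e), ∃ q ∈ Pv (tgt e),
          (src e = x.1 ∧ tgt e = u ∧ x.2 = k * D.ι (c₁ e) * p ∧ f = k * D.ι (c₂ e) * q) ∨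
          (src e = u ∧ tgt e = x.1 ∧ f = k * D.ι (c₁ e) * p ∧ x.2 = k * D.ι (c₂ e) * q)) ∧
        (∃ (e : E) (k : D.Hat), ∃ p ∈ Pv (src e), ∃ q ∈ Pv (tgt e),
          (src e = u ∧ tgt e = y.1 ∧ f = k * D.ι (c₁ e) * p ∧ y.2 = k * D.ι (c₂ e) * q) ∨
          (src e = y.1 ∧ tgt e = u ∧ y.2 = k * D.ι (c₁ e) * p ∧ f = k * D.ι (c₂ e) * q))))
    (fun x => x.2 ∈ D.ι.range) M ?_ ?_ ?_ ?_ hM γ hγ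
  · -- equivariance: `Π_{δ·(g ṽ)} = δ Π_{g ṽ} δ⁻¹`
    intro δ x
    change MulAut.conj (δ * x.2) • Pv x.1 = MulAut.conj δ • MulAut.conj x.2 • Pv x.1
    rw [map_mul, mul_smul]
  · -- (A1) in coordinates
    intro δ hδ
    obtain ⟨v, g, hg, hle⟩ := hA1 δ hδ
    exact ⟨(v, g), hg, hle⟩
  · -- (A3) in coordinates
    rintro ⟨v, g⟩ ⟨w, h⟩ δ h1 h2
    rcases hA3 v w g h δ h1 h2 with hsame | hadj | ⟨u, f, hxu, huy⟩
    · exact Or.inl hsame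
    · exact Or.inr (Or.inl hadj)
    · exact Or.inr (Or.inr ⟨u, f, hxu, huy⟩)
  · -- (T2): near a tempered vertex ⇒ tempered
    rintro ⟨v, g⟩ ⟨w, h⟩ hnear (hh : h ∈ D.ι.range)
    change g ∈ D.ι.range
    rcases hnear with ⟨-, hgh⟩ | hadj | ⟨u, f, hxu, huy⟩
    · have : g = h * (g⁻¹ * h)⁻¹ := by group
      rw [this]
      exact D.ι.range.mul_mem hh (D.ι.range.inv_mem (hPv _ hgh))
    · exact D.mem_range_of_adjacent Pv hPv src tgt c₁ c₂ hadj hh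
    · exact D.mem_range_of_adjacent Pv hPv src tgt c₁ c₂ hxu
        (D.mem_range_of_adjacent Pv hPv src tgt c₁ c₂ huy hh)
  · -- (T3): `g`, `δ g` tempered ⇒ `δ` tempered
    rintro δ ⟨v, g⟩ (hg : g ∈ D.ι.range) (hδg : δ * g ∈ D.ι.range)
    have : δ = δ * g * g⁻¹ := by group
    rw [this]
    exact D.ι.range.mul_mem hδg (D.ι.range.inv_mem hg)

end TemperedGraphGroupData

/-! ### B. (OBS) `LevelObservation` from the per-level arithmetic coset trees -/

namespace StableCurveTemperedData

namespace Prop24QTower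

variable {D : StableCurveTemperedData.{u}} (T : D.Prop24QTower)

/-- The image `M` in the level quotient `Π̂_j` of a subgroup `Λ ⊆ Π^tp_X` lies in `ι(Π^tp_j)` (compatibility `hq`).
([IUTchI] Prop 2.4(ii) p.50) [claim: Mochizuki2012, status: disputed] -/
theorem map_qhat_ιX_le_range (j : T.I) (Λ : Subgroup D.PiTp) :
    Λ.map ((T.qhat j).comp D.ιX) ≤ (T.Q j).ι.range := by
  rintro _ ⟨l, -, rfl⟩
  exact ⟨T.qtp j l, by rw [MonoidHom.comp_apply, T.hq j l]⟩

/-- The hypothesis of (OBS) — "`δ` conjugates the image of `Λ` into the tempered quotient" — says that the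
`δ`-conjugate of `M := q̂_j(ι(Λ))` lies in `ι(Π^tp_j)`. ([IUTchI] Prop 2.4(ii) p.50) [claim: Mochizuki2012, status: disputed] -/
theorem conj_map_le_range_of_forall (j : T.I) (Λ : Subgroup D.PiTp) (δ : (T.Q j).Hat)
    (hδ : ∀ l ∈ Λ, δ * T.qhat j (D.ιX l) * δ⁻¹ ∈ (T.Q j).ι.range) :
    MulAut.conj δ • Λ.map ((T.qhat j).comp D.ιX) ≤ (T.Q j).ι.range := by
  intro z hz
  rw [Subgroup.mem_smul_pointwise_iff_exists] at hz
  obtain ⟨_, ⟨l, hl, rfl⟩, rfl⟩ := hz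
  simpa only [MulAut.smul_def, MulAut.conj_apply, MonoidHom.comp_apply] using hδ l hl

/-- **(OBS) `LevelObservation` from the PRINTED inputs of "this observation", per level, in coset coordinates.**
Data at each level `j`: arithmetic verticial subgroups `Π_v ⊆ ι(Π^tp_j) ⊆ Π̂_j` of chosen tempered vertices and
nodes with tempered branch conjugators (the arithmetic pro-tree of `𝔾*_J`, [SemiAnbd] Ex 5.6).  Laws at each level
`j`, for every compact nontrivial `Λ ⊆ Π^tp_X` with open image in `G_k` and its image `M := q̂_j(ι(Λ))`:
(A1-arith) every conjugate `γMγ⁻¹ ⊆ ι(Π^tp_j)` lies in some `g Π_v g⁻¹` with `g` tempered ([SemiAnbd] Thm 5.4 (ii)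
/ Ex 5.6: the compact subgroup `ι⁻¹(γMγ⁻¹)` has open image in `G_k`); (A3-arith) if `γMγ⁻¹ ⊆ g Π_v g⁻¹ ∩ h Π_w h⁻¹`
then `g·ṽ_v`, `h·ṽ_w` coincide, are adjacent, or admit a common adjacent vertex ([AbsTopII] Prop 1.3 (iv) /
[NodNon] Prop 3.9 (i) after restricting to a pro-`Σ` subgroup of inertia).  The covering-space steps are proved
(`mem_range_of_cosetTree_orbit`). ([IUTchI] Prop 2.4(ii) pp.50-51) [claim: Mochizuki2012, status: disputed] -/
theorem levelObservation_of_cosetTrees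
    {V : T.I → Type*} (Pv : ∀ j, V j → Subgroup (T.Q j).Hat) (hPv : ∀ j v, Pv j v ≤ (T.Q j).ι.range)
    {E : T.I → Type*} (src tgt : ∀ j, E j → V j) (c₁ c₂ : ∀ j, E j → (T.Q j).Tp)
    (hA1 : ∀ (j : T.I) (Λ : Subgroup D.PiTp), IsCompact (Λ : Set D.PiTp) → Λ ≠ ⊥ →
      IsOpen (Λ.map D.prTp : Set D.Gk) → ∀ γ : (T.Q j).Hat,
        MulAut.conj γ • Λ.map ((T.qhat j).comp D.ιX) ≤ (T.Q j).ι.range →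
          ∃ (v : V j) (g : (T.Q j).Hat), g ∈ (T.Q j).ι.range ∧
            MulAut.conj γ • Λ.map ((T.qhat j).comp D.ιX) ≤ MulAut.conj g • Pv j v)
    (hA3 : ∀ (j : T.I) (Λ : Subgroup D.PiTp), IsCompact (Λ : Set D.PiTp) → Λ ≠ ⊥ →
      IsOpen (Λ.map D.prTp : Set D.Gk) → ∀ (v w : V j) (g h γ : (T.Q j).Hat),
        MulAut.conj γ • Λ.map ((T.qhat j).comp D.ιX) ≤ MulAut.conj g • Pv j v →
        MulAut.conj γ • Λ.map ((T.qhat j).comp D.ιX) ≤ MulAut.conj h • Pv j w →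
          (v = w ∧ g⁻¹ * h ∈ Pv j v) ∨
          (∃ (e : E j) (k : (T.Q j).Hat), ∃ p ∈ Pv j (src j e), ∃ q ∈ Pv j (tgt j e),
            (src j e = v ∧ tgt j e = w ∧ g = k * (T.Q j).ι (c₁ j e) * p ∧ h = k * (T.Q j).ι (c₂ j e) * q) ∨
            (src j e = w ∧ tgt j e = v ∧ h = k * (T.Q j).ι (c₁ j e) * p ∧ g = k * (T.Q j).ι (c₂ j e) * q)) ∨
          (∃ (u : V j) (f : (T.Q j).Hat),
            (∃ (e : E j) (k : (T.Q j).Hat), ∃ p ∈ Pv j (src j e), ∃ q ∈ Pv j (tgt j e),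
              (src j e = v ∧ tgt j e = u ∧ g = k * (T.Q j).ι (c₁ j e) * p ∧ f = k * (T.Q j).ι (c₂ j e) * q) ∨
              (src j e = u ∧ tgt j e = v ∧ f = k * (T.Q j).ι (c₁ j e) * p ∧ g = k * (T.Q j).ι (c₂ j e) * q)) ∧
            (∃ (e : E j) (k : (T.Q j).Hat), ∃ p ∈ Pv j (src j e), ∃ q ∈ Pv j (tgt j e),
              (src j e = u ∧ tgt j e = w ∧ f = k * (T.Q j).ι (c₁ j e) * p ∧ h = k * (T.Q j).ι (c₂ j e) * q) ∨
              (src j e = w ∧ tgt j e = u ∧ h = k * (T.Q j).ι (c₁ j e) * p ∧ f = k * (T.Q j).ι (c₂ j e) * q)))) :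
    T.LevelObservation := by
  intro j Λ hΛc hΛne hΛo δ hδ
  exact (T.Q j).mem_range_of_cosetTree_orbit (Pv j) (hPv j) (src j) (tgt j) (c₁ j) (c₂ j)
    (Λ.map ((T.qhat j).comp D.ιX)) (hA1 j Λ hΛc hΛne hΛo) (hA3 j Λ hΛc hΛne hΛo)
    (T.map_qhat_ιX_le_range j Λ) δ (T.conj_map_le_range_of_forall j Λ δ hδ)

end Prop24QTower

/-! ### C. Prop. 2.4 (ii) at the genuine 𝔛-datum with (OBS) so supplied -/

namespace OfSpecialFibre

open Literature.AnabelianGeometry.SemiGraphs Literature.AnabelianGeometry.SemiGraphs.ProfiniteSemiGraph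

variable {p : ℕ} [Fact p.Prime] (X : TemperedCurve p) (T : SpecialFibreTower X.DeltaTemp) (d : X.GroupLevelData)
  (S : SpecialFibreData (X.toTemperedArithmeticGroup d)) (h36 : S.Gc.Prop36Hypotheses)
  (Sigma SigmaHat : Set ℕ) (hsub : Sigma ⊆ SigmaHat) (hne : Set.Nonempty Sigma)
  (hprime : ∀ q ∈ SigmaHat, q.Prime) (hp : p ∉ Sigma) (TpH : Subgroup S.chart.G)
  (HatH : Subgroup (TemperedGraphGroupData.exists_completion_of_prop36 S.Gc h36 S.chart).choose)
  (hle : TpH.map (TemperedGraphGroupData.exists_completion_of_prop36 S.Gc h36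
    S.chart).choose_spec.choose.toMonoidHom ≤ HatH)
  (cuspMeetsH : {x : X.Pt // X.IsCusp x} → Prop)

/-- **[IUTchI] Prop. 2.4 (ii) AS TYPED at the genuine 𝔛-datum over `P : SpecialFibreTower.PiData`, with "this
observation" supplied from its printed inputs** — abc-iut-w4-d063's `prop24ii_ofPiData (P) (hadm) (hLev)` with
`hLev := levelObservation_of_cosetTrees …` for the genuine quotient tower `qTowerOfSpecialFibreTower … P.admKer_normal_pi`.
Laws: `hadm` (the admissible kernels shrink to `1`), (A1-arith) and (A3-arith) per level; data: per-level arithmetic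
verticial subgroups and node/branch data of the quotient charts.
([IUTchI] Prop 2.4(ii) pp.50-51) [claim: Mochizuki2012, status: disputed] -/
theorem prop24ii_ofPiData_of_cosetTrees (P : SpecialFibreTower.PiData X d S T)
    (hadm : ∀ U ∈ 𝓝 (1 : ↥X.DeltaTemp), ∃ j, ((T.admKer j : Subgroup ↥X.DeltaTemp) : Set ↥X.DeltaTemp) ⊆ U)
    {V : ℕ → Type*}
    (Pv : ∀ j, V j → Subgroup ((qTowerOfSpecialFibreTower X T d S h36 Sigma SigmaHat hsub hne hprime hp TpH HatH hle
      cuspMeetsH P.admKer_normal_pi).Q j).Hat)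
    (hPv : ∀ j v, Pv j v ≤ ((qTowerOfSpecialFibreTower X T d S h36 Sigma SigmaHat hsub hne hprime hp TpH HatH hle
      cuspMeetsH P.admKer_normal_pi).Q j).ι.range)
    {E : ℕ → Type*} (src tgt : ∀ j, E j → V j)
    (c₁ c₂ : ∀ j, E j → ((qTowerOfSpecialFibreTower X T d S h36 Sigma SigmaHat hsub hne hprime hp TpH HatH hle
      cuspMeetsH P.admKer_normal_pi).Q j).Tp)
    (hA1 : ∀ (j : ℕ) (Λ : Subgroup X.PiTemp), IsCompact (Λ : Set X.PiTemp) → Λ ≠ ⊥ →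
        IsOpen (Λ.map X.augGK.toMonoidHom : Set X.GK) → ∀ γ : ((qTowerOfSpecialFibreTower X T d S h36 Sigma SigmaHat hsub hne hprime hp TpH HatH hle cuspMeetsH P.admKer_normal_pi).Q j).Hat,
          MulAut.conj γ • Λ.map (((qTowerOfSpecialFibreTower X T d S h36 Sigma SigmaHat hsub hne hprime hp TpH HatH hle cuspMeetsH P.admKer_normal_pi).qhat j).comp X.toHat.toMonoidHom) ≤ ((qTowerOfSpecialFibreTower X T d S h36 Sigma SigmaHat hsub hne hprime hp TpH HatH hle cuspMeetsH P.admKer_normal_pi).Q j).ι.range →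
            ∃ (v : V j) (g : ((qTowerOfSpecialFibreTower X T d S h36 Sigma SigmaHat hsub hne hprime hp TpH HatH hle cuspMeetsH P.admKer_normal_pi).Q j).Hat), g ∈ ((qTowerOfSpecialFibreTower X T d S h36 Sigma SigmaHat hsub hne hprime hp TpH HatH hle cuspMeetsH P.admKer_normal_pi).Q j).ι.range ∧
              MulAut.conj γ • Λ.map (((qTowerOfSpecialFibreTower X T d S h36 Sigma SigmaHat hsub hne hprime hp TpH HatH hle cuspMeetsH P.admKer_normal_pi).qhat j).comp X.toHat.toMonoidHom) ≤ MulAut.conj g • Pv j v)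
    (hA3 : ∀ (j : ℕ) (Λ : Subgroup X.PiTemp), IsCompact (Λ : Set X.PiTemp) → Λ ≠ ⊥ →
        IsOpen (Λ.map X.augGK.toMonoidHom : Set X.GK) → ∀ (v w : V j) (g h γ : ((qTowerOfSpecialFibreTower X T d S h36 Sigma SigmaHat hsub hne hprime hp TpH HatH hle cuspMeetsH P.admKer_normal_pi).Q j).Hat),
          MulAut.conj γ • Λ.map (((qTowerOfSpecialFibreTower X T d S h36 Sigma SigmaHat hsub hne hprime hp TpH HatH hle cuspMeetsH P.admKer_normal_pi).qhat j).comp X.toHat.toMonoidHom) ≤ MulAut.conj g • Pv j v →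
          MulAut.conj γ • Λ.map (((qTowerOfSpecialFibreTower X T d S h36 Sigma SigmaHat hsub hne hprime hp TpH HatH hle cuspMeetsH P.admKer_normal_pi).qhat j).comp X.toHat.toMonoidHom) ≤ MulAut.conj h • Pv j w →
            (v = w ∧ g⁻¹ * h ∈ Pv j v) ∨
            (∃ (e : E j) (k : ((qTowerOfSpecialFibreTower X T d S h36 Sigma SigmaHat hsub hne hprime hp TpH HatH hle cuspMeetsH P.admKer_normal_pi).Q j).Hat), ∃ p ∈ Pv j (src j e), ∃ q ∈ Pv j (tgt j e),
              (src j e = v ∧ tgt j e = w ∧ g = k * ((qTowerOfSpecialFibreTower X T d S h36 Sigma SigmaHat hsub hne hprime hp TpH HatH hle cuspMeetsH P.admKer_normal_pi).Q j).ι (c₁ j e) * p ∧ h = k * ((qTowerOfSpecialFibreTower X T d S h36 Sigma SigmaHat hsub hne hprime hp TpH HatH hle cuspMeetsH P.admKer_normal_pi).Q j).ι (c₂ j e) * q) ∨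
              (src j e = w ∧ tgt j e = v ∧ h = k * ((qTowerOfSpecialFibreTower X T d S h36 Sigma SigmaHat hsub hne hprime hp TpH HatH hle cuspMeetsH P.admKer_normal_pi).Q j).ι (c₁ j e) * p ∧ g = k * ((qTowerOfSpecialFibreTower X T d S h36 Sigma SigmaHat hsub hne hprime hp TpH HatH hle cuspMeetsH P.admKer_normal_pi).Q j).ι (c₂ j e) * q)) ∨
            (∃ (u : V j) (f : ((qTowerOfSpecialFibreTower X T d S h36 Sigma SigmaHat hsub hne hprime hp TpH HatH hle cuspMeetsH P.admKer_normal_pi).Q j).Hat),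
              (∃ (e : E j) (k : ((qTowerOfSpecialFibreTower X T d S h36 Sigma SigmaHat hsub hne hprime hp TpH HatH hle cuspMeetsH P.admKer_normal_pi).Q j).Hat), ∃ p ∈ Pv j (src j e), ∃ q ∈ Pv j (tgt j e),
                (src j e = v ∧ tgt j e = u ∧ g = k * ((qTowerOfSpecialFibreTower X T d S h36 Sigma SigmaHat hsub hne hprime hp TpH HatH hle cuspMeetsH P.admKer_normal_pi).Q j).ι (c₁ j e) * p ∧ f = k * ((qTowerOfSpecialFibreTower X T d S h36 Sigma SigmaHat hsub hne hprime hp TpH HatH hle cuspMeetsH P.admKer_normal_pi).Q j).ι (c₂ j e) * q) ∨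
                (src j e = u ∧ tgt j e = v ∧ f = k * ((qTowerOfSpecialFibreTower X T d S h36 Sigma SigmaHat hsub hne hprime hp TpH HatH hle cuspMeetsH P.admKer_normal_pi).Q j).ι (c₁ j e) * p ∧ g = k * ((qTowerOfSpecialFibreTower X T d S h36 Sigma SigmaHat hsub hne hprime hp TpH HatH hle cuspMeetsH P.admKer_normal_pi).Q j).ι (c₂ j e) * q)) ∧
              (∃ (e : E j) (k : ((qTowerOfSpecialFibreTower X T d S h36 Sigma SigmaHat hsub hne hprime hp TpH HatH hle cuspMeetsH P.admKer_normal_pi).Q j).Hat), ∃ p ∈ Pv j (src j e), ∃ q ∈ Pv j (tgt j e),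
                (src j e = u ∧ tgt j e = w ∧ f = k * ((qTowerOfSpecialFibreTower X T d S h36 Sigma SigmaHat hsub hne hprime hp TpH HatH hle cuspMeetsH P.admKer_normal_pi).Q j).ι (c₁ j e) * p ∧ h = k * ((qTowerOfSpecialFibreTower X T d S h36 Sigma SigmaHat hsub hne hprime hp TpH HatH hle cuspMeetsH P.admKer_normal_pi).Q j).ι (c₂ j e) * q) ∨
                (src j e = w ∧ tgt j e = u ∧ h = k * ((qTowerOfSpecialFibreTower X T d S h36 Sigma SigmaHat hsub hne hprime hp TpH HatH hle cuspMeetsH P.admKer_normal_pi).Q j).ι (c₁ j e) * p ∧ f = k * ((qTowerOfSpecialFibreTower X T d S h36 Sigma SigmaHat hsub hne hprime hp TpH HatH hle cuspMeetsH P.admKer_normal_pi).Q j).ι (c₂ j e) * q)))) :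
    (ofSpecialFibre X d S h36 Sigma SigmaHat hsub hne hprime hp TpH HatH hle cuspMeetsH).Prop24ii :=
  prop24ii_ofPiData X T d S h36 Sigma SigmaHat hsub hne hprime hp TpH HatH hle cuspMeetsH P hadm
    (Prop24QTower.levelObservation_of_cosetTrees _ Pv hPv src tgt c₁ c₂ hA1 hA3)

end OfSpecialFibre

end StableCurveTemperedData

end Literature.IUT.HodgeTheaters

end
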